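import Summits.QuantumFields.BalabanUV.T4Continuum.Support.ShellMeasureLandauWilsonSquaresSchwarz
import Summits.QuantumFields.BalabanUV.T4Continuum.Support.ShellMeasureLandauWilsonSquaresLocated

/-!
# `T4Continuum.ShellMeasureLandauWilsonSquaresLocatedSchwarz` — row S85 f2, file 2: THE FULLY LOCATED WILSON `hE`,
# TWO RADII (S74 f3 `…Located` re-fired through S85: located second-order budget, NO `#P_w`, NO volume, NO `1∕(r_Φ∕S − 1)`)
(cell `pub-balaban`, sub-cell `t4`, spine estimate NE7c (node U5b); NE7c ROUND-2 crew, unit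
`b2b-balaban-t4-ne7c-formalise-leaf-09` gen 12; owner table `t4/b2b-balaban-t4-ne7c-p1/LEAVES-NE7c-P1.md` row **S85 f2**
(R-ne7cp1-g32-2 (b); CLAIM l.17994, file 1 = `ShellMeasureLandauWilsonSquaresSchwarz`); ADDITIVE — imports file 1
(`hE_landau_wilsonSquares_pinned_schwarz`) and S74 f3 `ShellMeasureLandauWilsonSquaresLocated` (`norm_readOut_le_pin`,
`norm_curl_le_pin`; hence f2's scalar bookkeeping `stokesSize_le_of_pinned`, `squareCost_le_of_pinned`) ONLY; [folklore];
0 `def`, 0 `def … : Prop`, 0 sorry, 0 citation tags)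

HONEST FRAMING.  Finite four-torus programme, rung (B)+1 only — NOT infinite volume, NOT a mass gap, NOT the Clay
problem, NOT summit progress; (B), `BetaPertHyp`, (B^μ) not consumed.  NE7c (`T4IndicatorShell.ShellWeightBound`) is
NOT PRINTED in [Balaban 1983–89] and NOT PROVED; «NE7c ⇐ the named binders» (trigger c3).  Nothing printed is asserted;
no estimate of Bałaban's is discharged; kernel plumbing carrying the owner's audit γ6 «COUPLING» (N-ne7cp1-g32-1; NOT a
K-uniformity failure) to the located Wilson supplier.  HONEST DEPENDENCY (cell): continuum YM on T⁴ ⇐ BetaPertH ∧ nine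
spine estimates (0/9 proved); BetaPertH ⇐ (D1) ∧ (D4) ∧ CAP+tail; G-an2-4 gates asym, D1 and NE2/3/4.

WHAT IS PROVED ([folklore]).
* §1 scalar bookkeeping in the two-radii shape: **`locatedSquareBudget_schwarz_le`** — per plaquette `κ_c p ≤ κ̄_c e_p`,
  `0 ≤ κ_w p ≤ κ̄_w e_p`, `d_p ≤ d̄`, `0 ≤ e_p ≤ 1` ⟹ `Σ_p |β|(d_p + 2S_p∕Rad)(2S_p∕Rad) ≤ |β|(d̄ + 2S̄∕Rad)(2S̄∕Rad)·Σ_p e_p`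
  (`S_p = κ_c p z + expTail₂(m κ_w p z)`, `S̄ = κ̄_c z + expTail₂(m κ̄_w z)`; f2's `stokesSize_le_of_pinned` ∕
  `squareCost_le_of_pinned` BY NAME); **`hsum_of_located_schwarz`** — file 1 §3's budget binder from located constants and
  `Σ_p e_p ≤ K`, any `H̄ ≥ |β|(d̄ + 2S̄∕Rad)(2S̄∕Rad)·K`.
* §2 **`hE_landau_wilsonSquares_located_schwarz`** — S74 f3 §2 VERBATIM (flat bond fields `Λ → 𝔄` read into
  `WSup (pinW δ′ ϖ) 1 𝔄` by `(WSup.toPiL (pinW δ′ ϖ) 1).symm`; weight read-outs BLIND off located supports of depth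
  `ϖP p`, flat op-norms `κ̄_w`, curl op-norm `κ̄_c`; `Σ_{p∈P_w} e^{−δ′ϖP p} ≤ K`) with `2S ≤ r_Φ` in place of `S < r_Φ`:
  END-II's `hE` for `𝓔_W` with **`B_𝓔 = 3·|β|·(d̄ + 2S̄∕(r_Φ∕S))·(2S̄∕(r_Φ∕S))·K`**, `S̄ = κ̄_c z_pin + expTail₂(m_w κ̄_w z_pin)`,
  `z_pin = B₁ₚbₚ∕((1 − q_W)(1 − L_C c_ι B_H))` — file 1 §3 with `κ_w p := κ̄_w e^{−δ′ϖP p}`, `κ_c p := κ̄_c e^{−δ′ϖP p}` (f3 §1)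
  and `hsum := hsum_of_located_schwarz`; **`hBW_located_schwarz`** (`0 ≤ B_𝓔`) — the pair (`hEW`, `hBW`) of S76 f2 for the
  Wilson slot, SECOND ORDER in `S∕r_Φ` (η-display as f2 v1.1 §5 ∕ S79: `(d̄ + 2S̄∕Rad)(2S̄∕Rad) ∝ η⁴` per fine plaquette,
  `K` in unit-lattice terms).
DISPLAYED, NOT DISCHARGED (c2): as f3 — the flat and pinned chain binders at this reading, blindness and the flat op-norms
of the concrete weight read-outs, `K`, the skew∕real structure, `B_p`, `d̄`.  NE7c NOT PROVED; spine PROVED 0∕9.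
-/

noncomputable section

open Set Metric NormedSpace
open scoped Matrix

namespace Summit.QuantumFields.BalabanUV.T4Continuum.ShellMeasureLandauWilsonSquaresLocatedSchwarz

open Literature.MathematicalPhysics.QuantumFieldTheory.Balaban1983to89
open B11Prop6Scheme (Prop4Hyp)
open T4ShellMeasurePlaquette (expTail₂ expTail₂_nonneg)
open Summit.QuantumFields.BalabanUV.T4Continuum.ShellMeasureMultiGridNorms (WSup)
open Summit.QuantumFields.BalabanUV.T4Continuum.ShellMeasurePinnedNorm (pinW)
open Summit.QuantumFields.BalabanUV.T4Continuum.ShellMeasureLandauHolonomy (solAt landauExp)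
open Summit.QuantumFields.BalabanUV.T4Continuum.ShellMeasureLandauHolonomyChart (holOf cplx)
open Summit.QuantumFields.BalabanUV.T4Continuum.ShellMeasureLandauWilsonSquaresPinned
  (stokesSize_le_of_pinned squareCost_le_of_pinned)
open Summit.QuantumFields.BalabanUV.T4Continuum.ShellMeasureLandauWilsonSquaresLocated
  (norm_readOut_le_pin norm_curl_le_pin)
open Summit.QuantumFields.BalabanUV.T4Continuum.ShellMeasureLandauWilsonSquaresSchwarz
  (hE_landau_wilsonSquares_pinned_schwarz)

/-! ## §1 Scalar bookkeeping: the located square budget in the two-radii shape -/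

section Scalar

/-- **THE LOCATED SQUARE BUDGET, TWO RADII**: per plaquette `κ_c p ≤ κ̄_c e_p`, `0 ≤ κ_w p ≤ κ̄_w e_p`, `0 ≤ κ_c p`,
`d_p ≤ d̄`, `0 ≤ e_p ≤ 1`, `0 ≤ z`, `0 ≤ κ̄_c`, `0 ≤ d̄`, `0 < Rad` ⟹
`Σ_{p∈P} |β|(d_p + 2S_p∕Rad)(2S_p∕Rad) ≤ |β|(d̄ + 2S̄∕Rad)(2S̄∕Rad)·Σ_{p∈P} e_p`, `S_p = κ_c p z + expTail₂(m κ_w p z)`,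
`S̄ = κ̄_c z + expTail₂(m κ̄_w z)` (f2 `stokesSize_le_of_pinned`: `S_p ≤ e_p S̄`; `squareCost_le_of_pinned`). [folklore] -/
theorem locatedSquareBudget_schwarz_le {𝔭 : Type*} (P : Finset 𝔭) {κc κw d e : 𝔭 → ℝ} {κc' κw' d' z β Rad : ℝ}
    {m : ℕ} (hRad : 0 < Rad) (he0 : ∀ p ∈ P, 0 ≤ e p) (he1 : ∀ p ∈ P, e p ≤ 1) (hz : 0 ≤ z) (hκc' : 0 ≤ κc')
    (hd' : 0 ≤ d') (hκc0 : ∀ p ∈ P, 0 ≤ κc p) (hκw0 : ∀ p ∈ P, 0 ≤ κw p)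
    (hκc : ∀ p ∈ P, κc p ≤ κc' * e p) (hκw : ∀ p ∈ P, κw p ≤ κw' * e p) (hd : ∀ p ∈ P, d p ≤ d') :
    ∑ p ∈ P, |β| * (d p + 2 * (κc p * z + expTail₂ (m * (κw p * z))) / Rad) *
        (2 * (κc p * z + expTail₂ (m * (κw p * z))) / Rad) ≤
      |β| * ((d' + 2 * (κc' * z + expTail₂ (m * (κw' * z))) / Rad) * (2 * (κc' * z + expTail₂ (m * (κw' * z))) / Rad)) *
        ∑ p ∈ P, e p := by
  rw [Finset.mul_sum]
  refine Finset.sum_le_sum fun p hp => ?_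
  set S' : ℝ := κc' * z + expTail₂ (m * (κw' * z)) with hS'def
  set Sp : ℝ := κc p * z + expTail₂ (m * (κw p * z)) with hSpdef
  have hS' : 0 ≤ S' := add_nonneg (mul_nonneg hκc' hz) (expTail₂_nonneg _)
  have hSp : 0 ≤ Sp := add_nonneg (mul_nonneg (hκc0 p hp) hz) (expTail₂_nonneg _)
  have hpin : Sp ≤ e p * S' := stokesSize_le_of_pinned (he0 p hp) (he1 p hp) hz (hκw0 p hp) (hκc p hp) (hκw p hp)
  have h2 : 2 * Sp / Rad ≤ e p * (2 * S' / Rad) := by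
    have h := div_le_div_of_nonneg_right (mul_le_mul_of_nonneg_left hpin zero_le_two) hRad.le
    calc 2 * Sp / Rad ≤ 2 * (e p * S') / Rad := h
      _ = e p * (2 * S' / Rad) := by ring
  have h := squareCost_le_of_pinned (he1 p hp) (div_nonneg (mul_nonneg zero_le_two hSp) hRad.le)
    (div_nonneg (mul_nonneg zero_le_two hS') hRad.le) hd' h2 (hd p hp)
  calc |β| * (d p + 2 * Sp / Rad) * (2 * Sp / Rad) = |β| * ((d p + 2 * Sp / Rad) * (2 * Sp / Rad)) := by ring
    _ ≤ |β| * ((d' + 2 * S' / Rad) * (2 * S' / Rad) * e p) := mul_le_mul_of_nonneg_left h (abs_nonneg β)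
    _ = |β| * ((d' + 2 * S' / Rad) * (2 * S' / Rad)) * e p := by ring

/-- **FILE 1 §3's BUDGET BINDER, LOCATED**: with `κ_c p ≤ κ̄_c e_p`, `κ_w p ≤ κ̄_w e_p`, `d_p ≤ d̄`, `0 ≤ e_p ≤ 1`,
`Σ_{p∈P_w} e_p ≤ K` (on the torus `K = #B₀·m₀·K₁ d δ′`: S69 `sum_exp_neg_pinDist_le`; η-free per S79), any
`H̄ ≥ |β|(d̄ + 2S̄∕Rad)(2S̄∕Rad)·K`, `S̄ = κ̄_c z + expTail₂(m_w κ̄_w z)`, is a budget for file 1 §3 (`z = z_pin`,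
`Rad = r_Φ∕S`) — NO `#P_w`, NO volume, SECOND ORDER in `1∕Rad`. [folklore] -/
theorem hsum_of_located_schwarz {𝔭 : Type*} (Pw : Finset 𝔭) {κc κw d e : 𝔭 → ℝ} {κc' κw' d' z β K Hbar Rad : ℝ}
    {mw : ℕ} (hRad : 0 < Rad) (he0 : ∀ p ∈ Pw, 0 ≤ e p) (he1 : ∀ p ∈ Pw, e p ≤ 1) (hz : 0 ≤ z) (hκc' : 0 ≤ κc')
    (hd' : 0 ≤ d') (hκc0 : ∀ p ∈ Pw, 0 ≤ κc p) (hκw0 : ∀ p ∈ Pw, 0 ≤ κw p)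
    (hκc : ∀ p ∈ Pw, κc p ≤ κc' * e p) (hκw : ∀ p ∈ Pw, κw p ≤ κw' * e p) (hd : ∀ p ∈ Pw, d p ≤ d')
    (hK : ∑ p ∈ Pw, e p ≤ K)
    (hH : |β| * ((d' + 2 * (κc' * z + expTail₂ (mw * (κw' * z))) / Rad) *
      (2 * (κc' * z + expTail₂ (mw * (κw' * z))) / Rad)) * K ≤ Hbar) :
    ∑ p ∈ Pw, |β| * (d p + 2 * (κc p * z + expTail₂ (mw * (κw p * z))) / Rad) *
        (2 * (κc p * z + expTail₂ (mw * (κw p * z))) / Rad) ≤ Hbar := by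
  have hS' : 0 ≤ κc' * z + expTail₂ (mw * (κw' * z)) := add_nonneg (mul_nonneg hκc' hz) (expTail₂_nonneg _)
  exact (locatedSquareBudget_schwarz_le Pw hRad he0 he1 hz hκc' hd' hκc0 hκw0 hκc hκw hd).trans
    ((mul_le_mul_of_nonneg_left hK (by positivity)).trans hH)

end Scalar

/-! ## §2 The fully located Wilson `hE` on the LD chain's chart rays, two radii -/

section Located

open scoped Matrix.Norms.L2Operator

variable {Λ : Type*} [Fintype Λ] [DecidableEq Λ] {𝔄 : Type*} [NormedAddCommGroup 𝔄] [NormedSpace ℂ 𝔄]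
  [CompleteSpace 𝔄]
variable {nM : Type*} [Fintype nM] [DecidableEq nM] [Nonempty nM]
variable {𝒴' 𝒳 𝒵 ℬ : Type*} [NormedAddCommGroup 𝒴'] [NormedSpace ℂ 𝒴'] [NormedAddCommGroup 𝒳] [NormedSpace ℂ 𝒳]
  [CompleteSpace 𝒳] [NormedAddCommGroup 𝒵] [NormedSpace ℂ 𝒵] [NormedAddCommGroup ℬ] [NormedSpace ℂ ℬ]
variable {P𝒴' P𝒳 Pℬ : Type*} [NormedAddCommGroup P𝒴'] [NormedSpace ℂ P𝒴'] [NormedAddCommGroup P𝒳]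
  [NormedSpace ℂ P𝒳] [NormedAddCommGroup Pℬ] [NormedSpace ℂ Pℬ]
variable {n : ℕ} {𝒢 : 𝒵 →L[ℂ] (Λ → 𝔄)} {W𝒱 : (Λ → 𝔄) → 𝒵} {B₀ C₄ a₃ : ℝ}

/-- **END-II's `hE` FOR THE WILSON PART, FULLY LOCATED — TWO RADII** (S74 f3 §2 `hE_landau_wilsonSquares_located`
re-fired through S85).  Data: f3 §2's VERBATIM — the chain's field space `Λ → 𝔄` read into `WSup (pinW δ′ ϖ) 1 𝔄` by
`π𝒴 := (WSup.toPiL (pinW δ′ ϖ) 1).symm`; the flat chain binders and leaf-07-g6's pinned chain binders AT THIS READING;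
weight read-outs `ℓw p`, each BLIND off a finite support `supp p` on which `ϖ ≥ ϖP p ≥ 0`, FLAT op-norms `‖ℓ‖ ≤ κ̄_w`,
curl op-norm `‖(ℓw p).sum‖ ≤ κ̄_c`, lengths `≤ m_w`, skew on the real structure; `B_p` unitary, `‖B_p − 1‖ ≤ d_p ≤ d̄`;
the located count `Σ_{p∈P_w} e^{−δ′ϖP p} ≤ K` — with `2S ≤ r_Φ` in place of `S < r_Φ`.  CONCLUSION: END-II's `hE` for
`𝓔_W y := Σ_{p∈P_w} β(1 − Re tr(B_p·holOf (ℓw p) Z y)∕N)` with the SECOND-ORDER located constant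
**`B_𝓔 = 3·(|β|·((d̄ + 2S̄∕(r_Φ∕S))·(2S̄∕(r_Φ∕S)))·K)`**, `S̄ = κ̄_c z_pin + expTail₂(m_w(κ̄_w z_pin))`,
`z_pin = B₁ₚbₚ∕((1 − q_W)(1 − L_C c_ι B_H))` — file 1 §3 with `κ_w p := κ̄_w e^{−δ′ϖP p}`, `κ_c p := κ̄_c e^{−δ′ϖP p}`
(f3 §1 `norm_readOut_le_pin` ∕ `norm_curl_le_pin`) and `hsum := hsum_of_located_schwarz` (`e_p := e^{−δ′ϖP p}`).
NO `#P_w`, no volume, no `1∕(r_Φ∕S − 1)`. [folklore] -/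
theorem hE_landau_wilsonSquares_located_schwarz {𝔭 : Type*} {W : Set (Fin n → ℝ)} {Pw : Finset 𝔭} {S : ℝ}
    (hS : 0 < S) (hWS : W ⊆ closedBall (0 : Fin n → ℝ) S)
    (h𝒢 : ∀ f, ‖𝒢 f‖ ≤ B₀ * ‖f‖) (hW : Prop4Hyp W𝒱 C₄ a₃) (hB₀ : 0 < B₀) (hC₄ : 0 ≤ C₄)
    {b ε₄ : ℝ} (hε₄ : 0 ≤ ε₄) (hdom : 2 * (ε₄ + B₀ * b) ≤ a₃)
    (hself : B₀ * C₄ * (ε₄ + B₀ * b) ^ 2 ≤ ε₄) (hcontr : 4 * B₀ * C₄ * (ε₄ + B₀ * b) < 1)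
    (H₁ : ℬ →L[ℂ] (Λ → 𝔄)) (hH₁ : ∀ B, ‖H₁ B‖ ≤ B₀ * ‖B‖)
    {Φ : (Fin n → ℂ) → ℬ} {rΦ : ℝ} (hΦd : DifferentiableOn ℂ Φ (ball 0 rΦ)) (hΦ0 : Φ 0 = 0)
    (hΦ : ∀ z ∈ ball (0 : Fin n → ℂ) rΦ, ‖Φ z‖ < b) (h2S : 2 * S ≤ rΦ)
    {C : 𝒴' → 𝒳} {C₂ R : ℝ} (hC₂ : 0 ≤ C₂) (hCq : ∀ Z : 𝒴', ‖Z‖ < R → ‖C Z‖ ≤ C₂ * ‖Z‖ ^ 2)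
    (hCd : DifferentiableOn ℂ C (ball 0 R)) (ι : (Λ → 𝔄) →L[ℂ] 𝒴') (hι : ∀ Y, ‖ι Y‖ ≤ ‖Y‖) (H : 𝒳 →L[ℂ] (Λ → 𝔄))
    (hH : ∀ X, ‖H X‖ ≤ B₀ * ‖X‖) (hq : 9 * C₂ * B₀ * (ε₄ + B₀ * b) < 1) (hRC : 3 * (ε₄ + B₀ * b) ≤ R)
    -- the pin and leaf-07's pinned chain binders AT THE READING OF RECORD (DISPLAYED)
    {δ' : ℝ} (hδ' : 0 ≤ δ') (ϖ : Λ → ℝ)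
    (π𝒴' : 𝒴' →L[ℂ] P𝒴') (π𝒳 : 𝒳 →L[ℂ] P𝒳) (πℬ : ℬ →L[ℂ] Pℬ) {qW LC cι BH B₁p bp : ℝ}
    (hGWp : ∀ Y Y', ‖Y‖ < ε₄ + B₀ * b → ‖Y'‖ < ε₄ + B₀ * b →
      ‖(WSup.toPiL (𝔄 := 𝔄) (pinW δ' ϖ) 1).symm (𝒢 (W𝒱 Y)) - (WSup.toPiL (𝔄 := 𝔄) (pinW δ' ϖ) 1).symm (𝒢 (W𝒱 Y'))‖ ≤
        qW * ‖(WSup.toPiL (𝔄 := 𝔄) (pinW δ' ϖ) 1).symm Y - (WSup.toPiL (𝔄 := 𝔄) (pinW δ' ϖ) 1).symm Y'‖)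
    (hqW : qW < 1)
    (hCp : ∀ A A' : 𝒴', ‖A‖ < R → ‖A'‖ < R → ‖π𝒳 (C A) - π𝒳 (C A')‖ ≤ LC * ‖π𝒴' A - π𝒴' A'‖)
    (hιp : ∀ Y, ‖π𝒴' (ι Y)‖ ≤ cι * ‖(WSup.toPiL (𝔄 := 𝔄) (pinW δ' ϖ) 1).symm Y‖)
    (hHp : ∀ X, ‖(WSup.toPiL (𝔄 := 𝔄) (pinW δ' ϖ) 1).symm (H X)‖ ≤ BH * ‖π𝒳 X‖)
    (hLC : 0 ≤ LC) (hcι : 0 ≤ cι) (hBH : 0 ≤ BH) (hk : LC * cι * BH < 1)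
    (hB₁p : 0 ≤ B₁p) (hH₁p : ∀ B, ‖(WSup.toPiL (𝔄 := 𝔄) (pinW δ' ϖ) 1).symm (H₁ B)‖ ≤ B₁p * ‖πℬ B‖)
    (hΦp : ∀ z ∈ ball (0 : Fin n → ℂ) rΦ, ‖πℬ (Φ z)‖ ≤ bp) (hbp : 0 ≤ bp)
    -- the weight read-outs: BLIND off located supports, FLAT op-norms, curl op-norm (DISPLAYED), lengths
    (ℓw : 𝔭 → List ((Λ → 𝔄) →L[ℂ] Matrix nM nM ℂ)) (supp : 𝔭 → Finset Λ) (ϖP : 𝔭 → ℝ)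
    (hblind : ∀ p ∈ Pw, ∀ ℓ ∈ ℓw p, ∀ A A' : Λ → 𝔄, (∀ b' ∈ supp p, A b' = A' b') → ℓ A = ℓ A')
    (hdepth : ∀ p ∈ Pw, ∀ b' ∈ supp p, ϖP p ≤ ϖ b') (hϖP : ∀ p ∈ Pw, 0 ≤ ϖP p)
    {κw' κc' : ℝ} (hκw' : 0 ≤ κw') (hκc' : 0 ≤ κc') (hℓw : ∀ p ∈ Pw, ∀ ℓ ∈ ℓw p, ‖ℓ‖ ≤ κw')
    (hcurl : ∀ p ∈ Pw, ‖(ℓw p).sum‖ ≤ κc')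
    {mw : ℕ} (hlenw : ∀ p ∈ Pw, (ℓw p).length ≤ mw)
    -- the real structure (chain (A)) with SKEW weight read-outs (chain (E))
    (𝓡𝒴 : AddSubgroup (Λ → 𝔄)) (h𝓡𝒴 : IsClosed (𝓡𝒴 : Set (Λ → 𝔄))) (𝓡𝒵 : AddSubgroup 𝒵)
    (𝓡𝒴' : AddSubgroup 𝒴') (𝓡𝒳 : AddSubgroup 𝒳) (h𝓡𝒳 : IsClosed (𝓡𝒳 : Set 𝒳)) (𝓡ℬ : AddSubgroup ℬ)
    (h𝒢r : ∀ f ∈ 𝓡𝒵, 𝒢 f ∈ 𝓡𝒴) (hWr : ∀ Y ∈ 𝓡𝒴, W𝒱 Y ∈ 𝓡𝒵) (hιr : ∀ Y ∈ 𝓡𝒴, ι Y ∈ 𝓡𝒴')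
    (hHr : ∀ X ∈ 𝓡𝒳, H X ∈ 𝓡𝒴) (hCr : ∀ Z ∈ 𝓡𝒴', C Z ∈ 𝓡𝒳) (hH₁r : ∀ B ∈ 𝓡ℬ, H₁ B ∈ 𝓡𝒴)
    (hΦr : ∀ y : Fin n → ℝ, ‖y‖ ≤ S → Φ (cplx y) ∈ 𝓡ℬ)
    (hskew : ∀ p ∈ Pw, ∀ ℓ ∈ ℓw p, ∀ Y ∈ 𝓡𝒴, ℓ Y ∈ skewAdjoint (Matrix nM nM ℂ))
    -- the frozen background plaquettes (N-ne7cp1-g31-2) and the located count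
    (Bp : 𝔭 → Matrix nM nM ℂ) {d : 𝔭 → ℝ} {dbar : ℝ} (hBu : ∀ p ∈ Pw, Bp p ∈ unitary (Matrix nM nM ℂ))
    (hBd : ∀ p ∈ Pw, ‖Bp p - 1‖ ≤ d p) (hd : ∀ p ∈ Pw, d p ≤ dbar) (hdbar : 0 ≤ dbar)
    {K : ℝ} (hK : ∑ p ∈ Pw, Real.exp (-(δ' * ϖP p)) ≤ K) (β : ℝ) :
    ∀ x ∈ W, ∀ c : ℝ, 1 / 2 ≤ c → c ≤ 1 →
      (fun y => ∑ p ∈ Pw, β * (1 - (Matrix.trace (Bp p * holOf (ℓw p) (fun y => landauExp C ι H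
        (4 * C₂ * (ε₄ + B₀ * b) ^ 2) (solAt 𝒢 0 W𝒱 ε₄ (0 : 𝒵) (H₁ (Φ (cplx y))) + H₁ (Φ (cplx y)))) y)).re /
          Fintype.card nM)) (c • x) ≤
      (fun y => ∑ p ∈ Pw, β * (1 - (Matrix.trace (Bp p * holOf (ℓw p) (fun y => landauExp C ι H
        (4 * C₂ * (ε₄ + B₀ * b) ^ 2) (solAt 𝒢 0 W𝒱 ε₄ (0 : 𝒵) (H₁ (Φ (cplx y))) + H₁ (Φ (cplx y)))) y)).re /
          Fintype.card nM)) x +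
        (1 - c) * (3 * (|β| * ((dbar + 2 * (κc' * (B₁p * bp / ((1 - qW) * (1 - LC * cι * BH))) +
          expTail₂ (mw * (κw' * (B₁p * bp / ((1 - qW) * (1 - LC * cι * BH)))))) / (rΦ / S)) *
          (2 * (κc' * (B₁p * bp / ((1 - qW) * (1 - LC * cι * BH))) +
            expTail₂ (mw * (κw' * (B₁p * bp / ((1 - qW) * (1 - LC * cι * BH)))))) / (rΦ / S))) * K)) := by
  set zpin : ℝ := B₁p * bp / ((1 - qW) * (1 - LC * cι * BH)) with hzpin
  have hk1 : 0 < 1 - LC * cι * BH := by linarith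
  have hs1 : 0 < 1 - qW := by linarith
  have hz : 0 ≤ zpin := div_nonneg (mul_nonneg hB₁p hbp) (mul_pos hs1 hk1).le
  have hRad : 0 < rΦ / S := div_pos (by linarith) hS
  -- the located constants and their sizes `e_p := e^{−δ′ϖP p} ∈ [0,1]`
  have he1 : ∀ p ∈ Pw, Real.exp (-(δ' * ϖP p)) ≤ 1 := fun p hp => by
    rw [Real.exp_le_one_iff, neg_nonpos]; exact mul_nonneg hδ' (hϖP p hp)
  refine hE_landau_wilsonSquares_pinned_schwarz hS hWS h𝒢 hW hB₀ hC₄ hε₄ hdom hself hcontr H₁ hH₁ hΦd hΦ0 hΦ h2S hC₂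
    hCq hCd ι hι H hH hq hRC ((WSup.toPiL (𝔄 := 𝔄) (pinW δ' ϖ) 1).symm : (Λ → 𝔄) →L[ℂ] WSup (pinW δ' ϖ) 1 𝔄)
    π𝒴' π𝒳 πℬ hGWp hqW hCp hιp hHp hLC hcι hBH hk hB₁p hH₁p hΦp hbp ℓw
    (κw := fun p => κw' * Real.exp (-(δ' * ϖP p))) (κc := fun p => κc' * Real.exp (-(δ' * ϖP p)))
    (fun p _ => mul_nonneg hκw' (Real.exp_nonneg _)) (fun p _ => mul_nonneg hκc' (Real.exp_nonneg _))
    (fun p hp ℓ hℓ Y => ?_) (fun p hp Y => ?_) hlenw 𝓡𝒴 h𝓡𝒴 𝓡𝒵 𝓡𝒴' 𝓡𝒳 h𝓡𝒳 𝓡ℬ h𝒢r hWr hιr hHr hCr hH₁r hΦr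
    hskew Bp hBu hBd ?_
  · -- a letter: S69 (B) at the reading of record (f3 §1)
    exact (norm_readOut_le_pin ℓ (supp p) (hblind p hp ℓ hℓ) hδ' ϖ (hdepth p hp) Y).trans
      (mul_le_mul_of_nonneg_right (mul_le_mul_of_nonneg_right (hℓw p hp ℓ hℓ) (Real.exp_nonneg _))
        (norm_nonneg _))
  · -- the curl: the summed read-out is blind off the same support (f3 §1)
    exact (norm_curl_le_pin (ℓw p) (supp p) (hblind p hp) hδ' ϖ (hdepth p hp) Y).trans
      (mul_le_mul_of_nonneg_right (mul_le_mul_of_nonneg_right (hcurl p hp) (Real.exp_nonneg _))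
        (norm_nonneg _))
  · -- the budget: §1 with `e_p := e^{−δ′ϖP p}`, `Rad := r_Φ∕S`
    simpa only [hzpin] using
      hsum_of_located_schwarz Pw (e := fun p => Real.exp (-(δ' * ϖP p))) hRad (fun p _ => Real.exp_nonneg _) he1
        hz hκc' hdbar (fun p _ => mul_nonneg hκc' (Real.exp_nonneg _)) (fun p _ => mul_nonneg hκw' (Real.exp_nonneg _))
        (fun p _ => le_rfl) (fun p _ => le_rfl) hd hK le_rfl

/-- … and S76 f2's `hBW`: the located two-radii constant is nonnegative (`0 ≤ K`, `0 ≤ d̄`, `0 ≤ κ̄_c`, `q_W < 1`,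
`k < 1`, `0 ≤ B₁ₚ`, `0 ≤ bₚ`, `0 < S`, `2S ≤ r_Φ`). [folklore] -/
theorem hBW_located_schwarz {S rΦ β dbar κc' κw' K qW LC cι BH B₁p bp : ℝ} {mw : ℕ} (hS : 0 < S)
    (h2S : 2 * S ≤ rΦ) (hdbar : 0 ≤ dbar) (hκc' : 0 ≤ κc') (hK : 0 ≤ K) (hqW : qW < 1) (hk : LC * cι * BH < 1)
    (hB₁p : 0 ≤ B₁p) (hbp : 0 ≤ bp) :
    0 ≤ 3 * (|β| * ((dbar + 2 * (κc' * (B₁p * bp / ((1 - qW) * (1 - LC * cι * BH))) +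
          expTail₂ (mw * (κw' * (B₁p * bp / ((1 - qW) * (1 - LC * cι * BH)))))) / (rΦ / S)) *
          (2 * (κc' * (B₁p * bp / ((1 - qW) * (1 - LC * cι * BH))) +
            expTail₂ (mw * (κw' * (B₁p * bp / ((1 - qW) * (1 - LC * cι * BH)))))) / (rΦ / S))) * K) := by
  have hk1 : 0 < 1 - LC * cι * BH := by linarith
  have hs1 : 0 < 1 - qW := by linarith
  have hz : 0 ≤ B₁p * bp / ((1 - qW) * (1 - LC * cι * BH)) := div_nonneg (mul_nonneg hB₁p hbp) (mul_pos hs1 hk1).le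
  have hSbar : 0 ≤ κc' * (B₁p * bp / ((1 - qW) * (1 - LC * cι * BH))) +
      expTail₂ (mw * (κw' * (B₁p * bp / ((1 - qW) * (1 - LC * cι * BH))))) :=
    add_nonneg (mul_nonneg hκc' hz) (expTail₂_nonneg _)
  have hRad : 0 < rΦ / S := div_pos (by linarith) hS
  positivity

end Located

end Summit.QuantumFields.BalabanUV.T4Continuum.ShellMeasureLandauWilsonSquaresLocatedSchwarz

end
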